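import Literature.IUT.HodgeArakelov.LabelClassesOfCuspsCor24ZHatAssembly
import HarnessLib

/-!
# [IUTchII] Cor 2.4 (i): the (B) binder `h23vi` WITH the printed hypothesis `I_t ⊆ Δ_{v□}` (binder repair, proof-only)

S. Mochizuki, *Inter-universal Teichmüller Theory II*, kurims manuscript (Dec. 2020), §2, Cor 2.4 (i), statement
p.69 l.−6 ("Let `I_t ⊆ Π_v` be a cuspidal inertia group that belongs to the class determined by `t` such that
`I_t ⊆ Δ_{v□}`") and proof p.70 l.−2 – p.71 l.3 ("by applying the equivalence of [IUTchI], Corollary 2.3, (vi) …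
to the various finite index open subgroups of `Δ^±_v`, it follows that `γ' ∈ Δ̂^±_{v□}`")
[cite: Mochizuki2012, II Cor 2.4 (i) pp.69-71] (D-0012 claim key, status disputed; PROOF-ONLY companion — no
definition, nothing of the series asserted; abc-iut cell, seat abc-iut-w5-d121, node `IUTchII:Cor2.4(i)` input (B) =
GAP-LEDGER G-w4d012-2).

WHY.  The landed discharge chain `cor24_i_of_inputs` (p411807) → `cor24_i'_of_inputs` (p412700) →
`cor24_i'_of_agreements` (p416675) → `cor24_i'_of_agreements_of_equiv_zHat` / `cor24_ii_iii'_of_agreements_of_equiv_zHat`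
(p417096) asks for the open-subgroup step (B) in the CLOSED form
`h23vi : ∀ γ' ∈ Δ^±_v, I^{γ'} ⊆ Π^±_{v□} → γ' ∈ cl(Δ^±_{v□})` — for EVERY admissible `Π_{v□}` and with NO access to the
printed hypotheses "`I_t` is a cuspidal inertia group of `Π_v`" and "`I_t ⊆ Δ_{v□}`": `cor24_i_of_inputs` discards them
(`intro _ _`), although `cor24_i_iff_c_imp_a` (p411807) shows that the typed `Cor24_i W C H I` needs (B) only UNDER
them.  The per-level derivation of (B) (abc-iut-w5-d132's `hlevel_of_levelData`, input `base`; abc-iut-L5-t11's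
`LevelTarget`, input `hmeet`) NEEDS the base incidence "the cusp of `I_t` meets `□`", i.e. `I_t ⊆ Δ_{v□}`.  This file
re-threads the two printed hypotheses through the chain: every `…_inc` theorem below has the SAME conclusion as its
landed namesake and the (B) binder (and, harmlessly, the (A) binder) prefixed by
`C.IsCuspidalInertia W.piV I → I ≤ W.deltaBox H →`.  Consequence: the capstones over the agreements need neither
`hIker` nor a separately passed `hI` any more (both come from `Cor24_i`'s own antecedents).  PROVED (re-assembly only;
no statement of record is touched; typed ≠ proved for the inputs, which stay hypotheses).  Nothing here bears on
[IUTchIII] Cor 3.12.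
-/

namespace Literature.IUT.HodgeArakelov

open Literature.IUT.HodgeTheaters
open Literature.AnabelianGeometry.SemiGraphs (IsProSigma)
open scoped Pointwise

universe u

section Cor24iInc

variable {S : BadPlaceSetting.{u}} {P : TopGroup.{u}} {T : TemperedCoverings S P}
  (W : PlusMinusTower T) (C : CuspidalInertiaData W) (H : Subgroup P) (I : Subgroup W.Corhat)

/-- **IUTchII:Cor2.4(i)** (kurims pp.69–71) `cor24_i_of_inputs` with the inputs (A) `h25` and (B) `h23vi` allowed to use
the printed hypotheses on `I_t` — "a cuspidal inertia group of `Π_v` … such that `I_t ⊆ Δ_{v□}`" (p.69 l.−6): from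
(A) [IUTchI] Cor 2.5 at the tower, (B) the open-subgroup step ("`γ' ∈ Δ̂^±_{v□}`", the closure) and (C) [IUTchI] Cor 2.3 (v)
at the tower — all HYPOTHESES — the typed `Cor24_i W C H I`.  PROVED (via `cor24_i_iff_c_imp_a`).
[claim: Mochizuki2012, status: disputed] -/
theorem cor24_i_of_inputs_inc
    (h25 : C.IsCuspidalInertia W.piV I → I ≤ W.deltaBox H →
      ∀ γ' : W.Corhat, γ' ∈ W.pmHat ⊓ W.aug.ker →
        I.map (MulAut.conj γ').toMonoidHom ≤ W.piPM → γ' ∈ W.piPM)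
    (h23vi : C.IsCuspidalInertia W.piV I → I ≤ W.deltaBox H →
      ∀ γ' : W.Corhat, γ' ∈ W.piPM ⊓ W.aug.ker →
        I.map (MulAut.conj γ').toMonoidHom ≤ W.pmBox H → γ' ∈ closure (W.deltaPmBox H : Set W.Corhat))
    (h23v : ∀ γ' : W.Corhat, γ' ∈ W.piPM ⊓ W.aug.ker →
      γ' ∈ closure (W.deltaPmBox H : Set W.Corhat) → γ' ∈ W.deltaPmBox H) :
    Literature.IUT.HodgeArakelov.Cor24_i W C H I := by
  rw [cor24_i_iff_c_imp_a]
  intro hI hIΔ γ' hγ' hc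
  have hpm : γ' ∈ W.piPM := h25 hI hIΔ γ' hγ' (hc.trans (W.pmNormalizer_le_piPM H))
  have hΔ : γ' ∈ W.piPM ⊓ W.aug.ker := Subgroup.mem_inf.mpr ⟨hpm, (Subgroup.mem_inf.mp hγ').2⟩
  exact (Subgroup.mem_inf.mp (h23v γ' hΔ (h23vi hI hIΔ γ' hΔ hc))).1

/-- **IUTchII:Cor2.4** preamble (kurims p.69) `Δ_{v□} ⊆ Δ^±_{v□}` (`Π_{v□} ⊆ N_{Π^±_v}(Π_{v□})`), and hence a cuspidal
inertia group `I_t ⊆ Δ_{v□}` lies in `Δ̂^cor_v`. PROVED. [claim: Mochizuki2012, status: disputed] -/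
theorem PlusMinusTower.deltaBox_le_deltaPmBox : W.deltaBox H ≤ W.deltaPmBox H :=
  inf_le_inf_right _ (W.box_le_pmNormalizer H)

end Cor24iInc

section AssemblyInc

variable {S : BadPlaceSetting.{u}} {P : TopGroup.{u}} {T : TemperedCoverings S P}
  {D : EtaleThetaData S.toThetaSetting P} {Dsc : StableCurveTemperedData.{u}}
  (Dec : SubgraphDecomposition S T D) (W : PlusMinusTower T) (C : CuspidalInertiaData W)
  {L : LabCuspStructure C} (Ld : LabelledDecomposition Dec L) (I : Subgroup W.Corhat)

/-- **IUTchII:Cor2.4(i)′** (kurims pp.69–71) `cor24_i'_of_inputs` with (A) and (B) under the printed hypotheses on `I_t`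
(see `cor24_i_of_inputs_inc`): the decl of record `Cor24_i' Dec W C Ld I` from (A) and, per admissible `Π_{v□}`,
(B) ∧ (C) — HYPOTHESES.  PROVED. [claim: Mochizuki2012, status: disputed] -/
theorem cor24_i'_of_inputs_inc
    (h25 : C.IsCuspidalInertia W.piV I →
      ∀ γ' : W.Corhat, γ' ∈ W.pmHat ⊓ W.aug.ker →
        I.map (MulAut.conj γ').toMonoidHom ≤ W.piPM → γ' ∈ W.piPM)
    (h23 : ∀ H : Subgroup P, Cor24_family Dec Ld H →
      (C.IsCuspidalInertia W.piV I → I ≤ W.deltaBox H →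
        ∀ γ' : W.Corhat, γ' ∈ W.piPM ⊓ W.aug.ker →
          I.map (MulAut.conj γ').toMonoidHom ≤ W.pmBox H → γ' ∈ closure (W.deltaPmBox H : Set W.Corhat)) ∧
        (∀ γ' : W.Corhat, γ' ∈ W.piPM ⊓ W.aug.ker →
          γ' ∈ closure (W.deltaPmBox H : Set W.Corhat) → γ' ∈ W.deltaPmBox H)) :
    Literature.IUT.HodgeArakelov.Cor24_i' Dec W C Ld I :=
  fun H hH => cor24_i_of_inputs_inc W C H I (fun hI _ => h25 hI) (h23 H hH).1 (h23 H hH).2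

/-- **IUTchII:Cor2.4(i)′ over the agreements, (B) under the printed hypotheses** (kurims pp.69–71): abc-iut-w4-d012's
`cor24_i'_of_agreements` (p416675) with the (B) binder `h23vi` receiving "`I_t` cuspidal in `Π_v`" and "`I_t ⊆ Δ_{v□}`",
and with `hIker` / `hΛ` produced INSIDE from those antecedents (`I ⊆ Δ_{v□} ⊆ Δ̂^cor_v`; `hΛ` per cuspidal `I`).
HYPOTHESES: `A`, `Dsc.Prop24i`, the datum `hΛ` for cuspidal `I`, the per-`□` dictionaries `Dic`, and (B).  PROVED.
[claim: Mochizuki2012, status: disputed] -/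
theorem cor24_i'_of_agreements_inc (A : W.StableCurveAgreement C Dsc) (h24i : Dsc.Prop24i)
    (hΛ : C.IsCuspidalInertia W.piV I →
      ∃ Λ : Subgroup Dsc.DeltaTp, IsCompact (Λ : Set Dsc.DeltaTp) ∧ Λ ≠ ⊥ ∧ IsProSigma Dsc.graph.Sigma Λ ∧
        (Λ.map Dsc.DeltaTp.subtype).map Dsc.ιX ≤ (I.subgroupOf W.pmHat).map A.eHat.toMonoidHom)
    (Dic : ∀ H : Subgroup P, Cor24_family Dec Ld H →
      ∃ (D' : StableCurveTemperedData.{u}) (A' : W.StableCurveAgreement C D'),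
        A'.SubgraphDictionary H ∧ D'.Cor23ii ∧ D'.Cor23v)
    (h23vi : ∀ H : Subgroup P, Cor24_family Dec Ld H →
      C.IsCuspidalInertia W.piV I → I ≤ W.deltaBox H →
        ∀ γ' : W.Corhat, γ' ∈ W.piPM ⊓ W.aug.ker →
          I.map (MulAut.conj γ').toMonoidHom ≤ W.pmBox H → γ' ∈ closure (W.deltaPmBox H : Set W.Corhat)) :
    Literature.IUT.HodgeArakelov.Cor24_i' Dec W C Ld I :=
  fun H hH => cor24_i_of_inputs_inc W C H I
    (fun hI hIΔ => A.inputA_of_prop24i h24i (hIΔ.trans (inf_le_right : W.deltaBox H ≤ W.aug.ker)) (hΛ hI))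
    (h23vi H hH)
    (by
      obtain ⟨D', A', hDic, h23ii, h23vD⟩ := Dic H hH
      exact A'.h23v hDic h23ii h23vD)

/-- **IUTchII:Cor2.4(i)′ over the agreements, Rmk 2.4.1 datum discharged, (B) under the printed hypotheses**
(kurims pp.69–71): `cor24_i'_of_agreements_of_equiv_zHat` (p417096) re-assembled through `cor24_i'_of_agreements_inc` —
NO `hI` / `hIker` arguments (they are `Cor24_i`'s own antecedents), and the (B) binder carries them.  HYPOTHESES: `A`,
`Dsc.Prop24i`, Def 2.3 (ii)′ `Def23_ii'`, `e : I_x ≃ₜ* Ẑ`, `Dic`, (B) `h23vi`.  PROVED. [claim: Mochizuki2012, status: disputed] -/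
theorem cor24_i'_of_agreements_of_equiv_zHat_inc (A : W.StableCurveAgreement C Dsc) (h24i : Dsc.Prop24i)
    (hrel' : Def23_ii' C W.piV W.piPM) (e : ∀ x : Dsc.Cusp, ↥(Dsc.inertiaTp x) ≃ₜ* HodgeTheaters.ZHat)
    (Dic : ∀ H : Subgroup P, Cor24_family Dec Ld H →
      ∃ (D' : StableCurveTemperedData.{u}) (A' : W.StableCurveAgreement C D'),
        A'.SubgraphDictionary H ∧ D'.Cor23ii ∧ D'.Cor23v)
    (h23vi : ∀ H : Subgroup P, Cor24_family Dec Ld H →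
      C.IsCuspidalInertia W.piV I → I ≤ W.deltaBox H →
        ∀ γ' : W.Corhat, γ' ∈ W.piPM ⊓ W.aug.ker →
          I.map (MulAut.conj γ').toMonoidHom ≤ W.pmBox H → γ' ∈ closure (W.deltaPmBox H : Set W.Corhat)) :
    Literature.IUT.HodgeArakelov.Cor24_i' Dec W C Ld I :=
  cor24_i'_of_agreements_inc Dec W C Ld I A h24i (fun hI => A.hΛ_of_equiv_zHat_of_def23ii' hrel' e I hI) Dic h23vi

/-- **IUTchII:Cor2.4(ii)(iii)′ over the agreements, Rmk 2.4.1 datum discharged, (B) under the printed hypotheses**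
(kurims p.70): `cor24_ii_iii'_of_agreements_of_equiv_zHat` (p417096) with the (B) binder in the form
`∀ I, ∀ admissible Π_{v□'}, I cuspidal in Π_v → I ⊆ Δ_{v□'} → …` — the form the per-level derivation supplies.
HYPOTHESES as there: `hH`, `A` over the target `□`'s datum with `Prop24i`, `Cor23Hyp`, `Cor23iii`, the `Π`-level entry
`hBox`; `Def23_ii'`, `e`; per-`□'` `Dic`; (B) `h23vi`; (E) `hcap`; (a.2) `hYdd`.  PROVED. [claim: Mochizuki2012, status: disputed] -/
theorem cor24_ii_iii'_of_agreements_of_equiv_zHat_inc {H : Subgroup P} (hH : Cor24_family Dec Ld H)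
    (A : W.StableCurveAgreement C Dsc) (h24i : Dsc.Prop24i) (hHyp : Dsc.Cor23Hyp) (h23iii : Dsc.Cor23iii)
    (hrel' : Def23_ii' C W.piV W.piPM) (e : ∀ x : Dsc.Cusp, ↥(Dsc.inertiaTp x) ≃ₜ* HodgeTheaters.ZHat)
    (Dic : ∀ H' : Subgroup P, Cor24_family Dec Ld H' →
      ∃ (D' : StableCurveTemperedData.{u}) (A' : W.StableCurveAgreement C D'),
        A'.SubgraphDictionary H' ∧ D'.Cor23ii ∧ D'.Cor23v)
    (hBox : ((W.pmBox H).subgroupOf W.pmHat).map A.eHat.toMonoidHom = Dsc.piTpXH.map Dsc.ιX)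
    (h23vi : ∀ I : Subgroup W.Corhat, ∀ H' : Subgroup P, Cor24_family Dec Ld H' →
      C.IsCuspidalInertia W.piV I → I ≤ W.deltaBox H' →
        ∀ γ' : W.Corhat, γ' ∈ W.piPM ⊓ W.aug.ker →
          I.map (MulAut.conj γ').toMonoidHom ≤ W.pmBox H' → γ' ∈ closure (W.deltaPmBox H' : Set W.Corhat))
    (hcap : W.pmBox H ⊓ W.piV ≤ W.box H)
    (hYdd : ∀ I : Subgroup W.Corhat, C.IsCuspidalInertia W.piV I → I ≤ W.deltaBox H →
      W.cuspDecomp I 1 ≤ (T.YddL).map (W.emb.comp T.incl)) :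
    Literature.IUT.HodgeArakelov.Cor24_ii_iii' W C H :=
  cor24_ii_iii'_of_inputs
    (fun I _ _ => cor24_i'_of_agreements_of_equiv_zHat_inc Dec W C Ld I A h24i hrel' e Dic (h23vi I) H hH)
    (A.boxOntoGalois_of_cor23iii hBox hHyp h23iii) hcap hYdd

end AssemblyInc

end Literature.IUT.HodgeArakelov
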